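import Summits.HodgeConjecture.HodgeConjecture.Theorems.MarkmanPartnerTransportK3Sq2KugaSatakeMixedPresentationXS
import Summits.HodgeConjecture.HodgeConjecture.Theorems.MarkmanPartnerTransportK3Sq2KugaSatakeMixedTranspose
import Literature.AlgebraicGeometry.Motives.HodgeStructureK3RealMultProofs

/-!
# Route MarkmanPartnerTransport · support `PartnerTransport` (stmt-HodgeConjecture-19650) ∕ crux #4 — programme
# «KS-MIXED», step M4′: A RATIONAL TRANSCENDENTAL HODGE SIMILITUDE `H²(X) → H²(S)` (marked `K3^{[2]}`-type FOURFOLD →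
# K3-type SURFACE) IS ALGEBRAIC ON `T(X)`, GRANTED KUGA–SATAKE ON BOTH SIDES

The direction `X → S` of Varesco's Cor. 4.6 in the mixed case (companion of `…MixedSimilitudeSX`): presentations of
`X` on `(T', Pol)` and of `S` on `(T', |m'|·Pol, ε')` (`…MixedMultiplier`, `…MixedPresentationXS`), ONE Kuga–Satake
variety (`exists_two_correspondences_of_kugaSatake_mixed'`), the Lefschetz–transpose into the SURFACE
(`exists_lefschetzTranspose_toSurface` — no `B(X)` needed in this direction), rational descent `a₂ ∘ h_T = a₁ ≠ 0`
with `a₂` cycle-induced in the FIELD `End_Hdg(T(S)_ℚ)` (Zarhin) and `a₁` induced by correspondences `X → S`,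
subfield trick. Single theorem `exists_algebraicCorrespondence_eq_of_similitude_of_kugaSatake_XS`.

CONDITIONAL on the two Kuga–Satake hypotheses (open in print); THEOREMS ONLY; no sorry, no definition, no new named
fact; nothing here says HC or any item is proved. Prover seat hodge-nonav-19652-p1 (gen 16),
`--supports stmt-HodgeConjecture-19650`.

References: M. Varesco, Math. Z. 305 (2023) §0.3, Thm. 4.5, Cor. 4.6, Thm. 5.3; Yu. Zarhin, J. reine angew. Math.
341 (1983) Thm. 1.5.1; S. Floccari, arXiv:2210.02948 §5.1; W. Fulton, *Intersection Theory* §16.1.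
-/

set_option linter.dupNamespace false

noncomputable section

namespace Summit.HodgeConjecture.HodgeConjecture.Theorems.MarkmanPartnerTransport.KugaSatakeMixed

open scoped TensorProduct
open CategoryTheory MonoidalCategory Literature.AlgebraicGeometry Literature.AlgebraicGeometry.Motives
open Literature.AlgebraicGeometry.HodgeTheory Literature.AlgebraicTopology.SingularHomology
open Literature.AlgebraicGeometry.Motives.HodgeStructure Literature.AlgebraicGeometry.Hyperkaehler
open Literature.AlgebraicGeometry.Surfaces
open Summit.HodgeConjecture.HodgeConjecture.Ring2.AbelianAll
open Summit.HodgeConjecture.HodgeConjecture.Theorems.OddPrimeSquares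
open Summit.HodgeConjecture.HodgeConjecture.Theorems.NikulinTwinTransport
open Summit.HodgeConjecture.HodgeConjecture.Theorems.MarkmanPartnerTransport.TranscendentalPresentation
open Summit.HodgeConjecture.HodgeConjecture.Theorems.MarkmanPartnerTransport.KugaSatakeSelf
open Summit.HodgeConjecture.HodgeConjecture.Theorems.MarkmanPartnerTransport.KugaSatakePair
open Summit.HodgeConjecture.HodgeConjecture.Theorems.MarkmanPartnerTransport.KugaSatakeHK

variable {S X : SchemeOver ℂ} {φ : complexBetti X 2 ≃ₗ[ℂ] (K3HilbertIndex → ℂ)} {PX : complexBetti X (2 * 4)}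
  {z : K3HilbertIndex → ℂ}

/-- `MarkedK3Sq[X, φ, P, z]`: VERBATIM the `let MarkedK3Sq := …` binder of the route declarations of
MarkmanPartnerTransport (clauses (m1)–(m6)). Local notation only. -/
local notation3 (prettyPrint := false) "MarkedK3Sq[" X ", " φ ", " P ", " z "]" =>
  (((IsIntegralClass P ∧ ∀ Q : complexBetti X (2 * 4), IsIntegralClass Q → ∃ n : ℤ, Q = n • P) ∧
    (∀ c : complexBetti X 2, IsIntegralClass c ↔ ∃ v : K3HilbertIndex → ℤ, φ c = fun i => (v i : ℂ)) ∧
    (∀ a : complexBetti X 2, cupPowTwo a 4 = ((3 : ℂ) * (k3HilbertForm 2 (φ a) (φ a)) ^ 2) • P) ∧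
    (IsOfHodgeType 4 X 2 2 0 (LinearEquiv.symm φ z) ∧
      ∀ τ : complexBetti X 2, IsOfHodgeType 4 X 2 2 0 τ → ∃ t : ℂ, τ = t • LinearEquiv.symm φ z) ∧
    (∀ c : complexBetti X 2, IsOfHodgeType 4 X 2 1 1 c ↔
      (k3HilbertForm 2 (φ c) z = 0 ∧ k3HilbertForm 2 (φ c) (star z) = 0)) ∧
    (k3HilbertForm 2 z z = 0 ∧ 0 < (k3HilbertForm 2 (star z) z).re)))

/-- `H²[hS]`: the weight-two `ℚ`-Hodge structure on `H²(S(ℂ); ℚ)` of the real Hodge model of the surface `S`. -/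
local notation3 "H²[" hS "]" =>
  bettiTwoHodgeStructure hS (BettiUniverse.realHodgeModel exists_isReal_hodgeModel_holds hS)
    (BettiUniverse.realHodgeModel_isHodgeSymmetric exists_isReal_hodgeModel_holds hS)

/-- `T[hS] = T(S)_ℚ = Hdg¹^⊥ ⊆ H²(S(ℂ); ℚ)`. -/
local notation3 "T[" hS "]" =>
  transcendentalLatticeBetti hS (BettiUniverse.realHodgeModel exists_isReal_hodgeModel_holds hS)
    (BettiUniverse.realHodgeModel_isHodgeSymmetric exists_isReal_hodgeModel_holds hS)

/-- `H²_B[hX]`: the weight-two `ℚ`-Hodge structure on `H²(X(ℂ); ℚ)` of the real Hodge model of the fourfold `X`. -/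
local notation3 "H²_B[" hX "]" =>
  bettiTwoHodgeStructureOfModel hX (BettiUniverse.realHodgeModel exists_isReal_hodgeModel_holds hX)
    (BettiUniverse.realHodgeModel_isHodgeSymmetric exists_isReal_hodgeModel_holds hX)

/-- `Θ : ℂ ⊗_ℚ H²(Y(ℂ); ℚ) → H²(Y(ℂ); ℂ)`. -/
local notation3 "Θ[" Y "]" => ofRatClassBaseChange (Motives.ComplexPoints Y) (2 * 1)

/-- `ι : H²(Y(ℂ); ℚ) → H²(Y(ℂ); ℂ)`, the rational lattice. -/
local notation3 "ι[" Y "]" => ofRatClass (Motives.ComplexPoints Y) (2 * 1)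

/-- `Transc[S, y]`: `y` is cup-orthogonal to `N¹(S) = algebraicClasses S 1`. Local notation only. -/
local notation3 (prettyPrint := false) "Transc[" S ", " y "]" =>
  (∀ d ∈ algebraicClasses S 1, cupProduct (rfl : 2 * 1 + 2 * 1 = 2 * 2) y d = 0)

/-- `BBF[X, φ, y]`: `y` is `q`-orthogonal to `N¹(X) = algebraicClasses X 1`. -/
local notation3 (prettyPrint := false) "BBF[" X ", " φ ", " y "]" =>
  (∀ e : complexBetti X 2, e ∈ algebraicClasses X 1 → k3HilbertForm 2 (φ y) (φ e) = 0)

/-! ### The theorem -/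

set_option maxHeartbeats 400000 in
/-- **A RATIONAL TRANSCENDENTAL HODGE SIMILITUDE `H²(X) → H²(S)` IS ALGEBRAIC ON `T(X)`, GRANTED KUGA–SATAKE FOR
`X` AND `S`** (Varesco's Cor. 4.6, marked `K3^{[2]}`-type fourfold → K3-type surface). Data: `S` with `(2,0)`-classes
the line `ℂσ ≠ 0` and `IsKSCorrespondenceAlgebraicBetti` (HYPOTHESIS); `(X, φ, P, z)` marked with
`IsKSCorrespondenceAlgebraicHK 2` (HYPOTHESIS); `h` rational, type-preserving, with cup-transcendental image, injective
on `T(X)_ℂ`, onto `T(S)_ℂ`, `∫_S h y ∪ h w = μ' q(φ y, φ w)` on `T(X)_ℂ`, `μ' ≠ 0`. Conclusion: some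
`Φ : H²(X) → H²(S)` INDUCED BY AN ALGEBRAIC CYCLE on `S × X` equals `h` on `T(X)_ℂ`. CONDITIONAL.
[cite: Varesco2023, Cor. 4.6, Thm. 4.5 and §0.3] [cite: Zarhin1983HodgeGroupsK3, Thm. 1.5.1] [cite: Floccari2024, §5.1] -/
theorem exists_algebraicCorrespondence_eq_of_similitude_of_kugaSatake_XS
    (hS : IsSmoothProjective 2 S) {σ : complexBetti S (2 * 1)} (hσ : IsOfHodgeType 2 S (2 * 1) 2 0 σ) (hσ0 : σ ≠ 0)
    (hline : ∀ c : complexBetti S (2 * 1), IsOfHodgeType 2 S (2 * 1) 2 0 c → ∃ t : ℂ, c = t • σ)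
    (hX : IsSmoothProjective (2 * 2) X) (hM : MarkedK3Sq[X, φ, PX, z])
    (hKS : IsKSCorrespondenceAlgebraicBetti hS) (hKSX : IsKSCorrespondenceAlgebraicHK 2 hX)
    (h : complexBetti X 2 →ₗ[ℂ] complexBetti S (2 * 1))
    (h1 : ∀ y, IsRationalClass y → IsRationalClass (h y))
    (h2 : ∀ (i j : ℕ) y, IsOfHodgeType 4 X 2 i j y → IsOfHodgeType 2 S (2 * 1) i j (h y))
    (h4 : ∀ y : complexBetti X 2, Transc[S, h y])
    (hinj : ∀ y : complexBetti X 2, BBF[X, φ, y] → h y = 0 → y = 0)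
    (hsurj : ∀ y' : complexBetti S (2 * 1), Transc[S, y'] → ∃ y, BBF[X, φ, y] ∧ h y = y')
    {μ' : ℂ} (hμ' : μ' ≠ 0)
    (hmul : ∀ y w : complexBetti X 2, BBF[X, φ, y] → BBF[X, φ, w] →
      traceC hS (cupProduct (rfl : 2 * 1 + 2 * 1 = 2 * 2) (h y) (h w)) = μ' * k3HilbertForm 2 (φ y) (φ w)) :
    ∃ Φ : complexBetti X 2 →ₗ[ℂ] complexBetti S (2 * 1), IsAlgebraicCorrespondence 2 4 S X Φ ∧
      ∀ y : complexBetti X 2, BBF[X, φ, y] → Φ y = h y := by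
  classical
  have hX4 : IsSmoothProjective 4 X := hX
  haveI := BettiUniverse.finite hS (2 * 1); haveI := BettiUniverse.finite hX (2 * 1)
  obtain ⟨-, hint, -, ⟨h20, hspan⟩, -, -, hzpos⟩ := id hM
  -- the presentations of `S` and `X`
  obtain ⟨T, P, ε, hT, htrS, hirr, hK3, hj⟩ := exists_isTranscendentalPartBetti_trPart hS hσ hσ0 hline
  obtain ⟨b, T', Pol, hb, hbq, hirr', hK3T', htr', -, hj'⟩ := exists_isTranscendentalPartHK hX hM
  haveI := Module.Finite.of_injective T'.toSubmodule.subtype T'.toSubmodule.injective_subtype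
  have hT' := mem_toSubmodule_iff_of_isTranscendentalPartHK hX hbq hj'
  -- `h_T : Hom T' T`, bijective
  obtain ⟨hTT, hhT⟩ := exists_hom_transcendental_XS hS hX T' T hT h h1 h2 h4
  have hbij : Function.Bijective hTT.toLinearMap := hom_transcendental_bijective_XS hM hT hT' hhT hinj hsurj
  -- the period `σ_X = φ⁻¹ z = Θ_X(sub' x₀)`, `x₀ ≠ 0`, `T' ≠ 0`
  have hσX0 : φ.symm z ≠ 0 := by
    intro h0
    have hz : z = 0 := by rw [← φ.apply_symm_apply z, h0, map_zero]
    rw [hz, bbf_zero_right, Complex.zero_re] at hzpos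
    exact lt_irrefl _ hzpos
  obtain ⟨x₀, hx₀⟩ := exists_baseChange_eq_of_bbfTransc hX hM T' hT' (bbfTransc_of_twoZero hX hM h20)
  have hx₀0 : x₀ ≠ 0 := by rintro rfl; exact hσX0 (by rw [← hx₀, map_zero, map_zero])
  have hT'0 : T'.toSubmodule ≠ ⊥ := Submodule.nontrivial_iff_ne_bot.1 hirr'.1
  -- the rational multiplier and the transported presentation of `S` on `(T', |m'|·Pol, ε')`
  obtain ⟨m', hm'0, hmulQ⟩ := exists_rat_multiplier_XS hS hX hj hbq hj' hT'0 hT' hhT hμ' hmul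
  obtain ⟨ε', hjS⟩ := exists_isTranscendentalPartBetti_transport_XS hS hj hbij hm'0 hmulQ
  -- the two correspondences into one Kuga–Satake square (`X` on `Pol`, `S` on `|m'|·Pol`)
  obtain ⟨A, μK, O₁, O₂, hμK, hO₁, hO₂, hO₁j, hO₂j⟩ :=
    exists_two_correspondences_of_kugaSatake_mixed' hS hX hKS hKSX hb hK3T' hj' (abs_pos.2 hm'0) hjS
  have hA : IsSmoothProjective A.dim A.X := AbelianVariety.isSmoothProjective_holds
  have hY : IsSmoothProjective (A.dim + A.dim) (A.X ⊗ A.X) := hA.tensor_holds hA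
  have hn : 2 ≤ A.dim + A.dim := by have h := IsAlgebraicCorrespondence.le_two_mul hO₂; omega
  have hO₁' : IsAlgebraicCorrespondence (A.dim + A.dim) 4 (A.X ⊗ A.X) X O₁ := hO₁
  -- the Lefschetz–transpose into `S`
  obtain ⟨R, hΦ₁, hΦ₂, hne⟩ := exists_lefschetzTranspose_toSurface hS hY hn hX4 hO₁' hO₂
  -- `j'' = ι_T ∘ h_T` and its complexification
  set j'' : T'.toSubmodule →ₗ[ℚ] bettiCohomology S (2 * 1) := T.toSubmodule.subtype ∘ₗ hTT.toLinearMap with hj''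
  have hψx : ∀ x : ℂ ⊗[ℚ] T'.toSubmodule, h (Θ[X] (T'.toSubmodule.subtype.baseChange ℂ x)) =
      Θ[S] (j''.baseChange ℂ x) := by
    intro x
    induction x using TensorProduct.induction_on with
    | zero => simp only [map_zero]
    | tmul c t =>
      rw [LinearMap.baseChange_tmul, Submodule.subtype_apply, ofRatClassBaseChange_tmul, map_smul,
        LinearMap.baseChange_tmul, ofRatClassBaseChange_tmul, hj'', LinearMap.comp_apply, Submodule.subtype_apply, hhT]
    | add x y hx hy => simp only [map_add, hx, hy]
  -- `O₁` on `Θ_X(T'_ℂ)` and `O₂` on `Θ_S(j''(T')_ℂ)`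
  have hO₁x : ∀ x : ℂ ⊗[ℚ] T'.toSubmodule, O₁ (Θ[X] (T'.toSubmodule.subtype.baseChange ℂ x)) =
      ofRatClassBaseChange (Motives.ComplexPoints (A.X ⊗ A.X)) 2 (μK.baseChange ℂ x) := by
    intro x
    induction x using TensorProduct.induction_on with
    | zero => simp only [map_zero]
    | tmul c t =>
      rw [LinearMap.baseChange_tmul, Submodule.subtype_apply, ofRatClassBaseChange_tmul, map_smul,
        LinearMap.baseChange_tmul, ofRatClassBaseChange_tmul]
      exact congrArg _ (hO₁j t)
    | add x y hx hy => simp only [map_add, hx, hy]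
  have hO₂x : ∀ x : ℂ ⊗[ℚ] T'.toSubmodule, O₂ (Θ[S] (j''.baseChange ℂ x)) =
      ofRatClassBaseChange (Motives.ComplexPoints (A.X ⊗ A.X)) 2 (μK.baseChange ℂ x) := by
    intro x
    induction x using TensorProduct.induction_on with
    | zero => simp only [map_zero]
    | tmul c t =>
      rw [LinearMap.baseChange_tmul, ofRatClassBaseChange_tmul, map_smul, LinearMap.baseChange_tmul,
        ofRatClassBaseChange_tmul]
      exact congrArg _ (hO₂j t)
    | add x y hx hy => simp only [map_add, hx, hy]
  have hμC : Function.Injective (μK.baseChange ℂ) := by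
    rw [LinearMap.baseChange_eq_ltensor]
    exact Module.Flat.lTensor_preserves_injective_linearMap _ hμK
  -- `O₂ (h σ_X)` is a non-zero `(2,0)`-class with `O₂ \bar{hσ_X} = \overline{O₂ hσ_X}`
  have hO₂σ0 : O₂ (h (φ.symm z)) ≠ 0 := by
    rw [← hx₀, hψx, hO₂x]
    exact fun h0 => hx₀0 (hμC (ofRatClassBaseChange_injective _ _ (by rw [h0, map_zero, map_zero])))
  have hO₂conj : O₂ (conjClass _ (2 * 1) (h (φ.symm z))) = conjClass _ 2 (O₂ (h (φ.symm z))) := by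
    rw [← hx₀, hψx, ← ofRatClassBaseChange_conj_eq hS, conj_baseChange, hO₂x, hO₂x, ← conj_baseChange]
    exact KaehlerRationalDatum.ofRatClassBaseChange_conj hY
      (BettiUniverse.realHodgeModel exists_isReal_hodgeModel_holds hY) _
  have hΦ₂σ : (R ∘ₗ O₂) (h (φ.symm z)) ≠ 0 :=
    hne _ (isOfHodgeType_two_zero_of_isAlgebraicCorrespondence hY hS hO₂ (h2 _ _ _ h20)) hO₂σ0 hO₂conj
  -- `O₁ σ_X = O₂ (h σ_X)`, so `f₁ σ_X ≠ 0`
  have hO₁σ : O₁ (φ.symm z) = O₂ (h (φ.symm z)) := by rw [← hx₀, hO₁x, hψx, hO₂x]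
  have hΦ₁σ : (R ∘ₗ O₁) (φ.symm z) ≠ 0 := by rw [LinearMap.comp_apply, hO₁σ]; exact hΦ₂σ
  -- `f₂ ∘ h = f₁` on `T(X)_ℚ`
  have hrel : ∀ t : T'.toSubmodule, (R ∘ₗ O₂) (h (ι[X] (t : bettiCohomology X (2 * 1)))) =
      (R ∘ₗ O₁) (ι[X] (t : bettiCohomology X (2 * 1))) := by
    intro t
    rw [LinearMap.comp_apply, LinearMap.comp_apply, ← hhT]
    exact congrArg R ((hO₂j t).trans (hO₁j t).symm)
  -- the cycle-induced Hodge endomorphisms of `T` (self-correspondences of `S`)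
  let Rs : Submodule ℚ (Module.End ℚ T.toSubmodule) :=
    { carrier := {a | a ∈ T.toHodgeStructure.endAlg ∧
        ∃ f : complexBetti S (2 * 1) →ₗ[ℂ] complexBetti S (2 * 1), IsAlgebraicCorrespondence 2 2 S S f ∧
          ∀ t : T.toSubmodule, f (ι[S] (t : bettiCohomology S (2 * 1))) =
            ι[S] ((a t : T.toSubmodule) : bettiCohomology S (2 * 1))}
      add_mem' := by
        rintro a a' ⟨haE, f, hf, hfa⟩ ⟨hbE, f', hf', hfb⟩
        refine ⟨add_mem haE hbE, f + f', IsAlgebraicCorrespondence.add hS hS hf hf', fun t => ?_⟩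
        rw [LinearMap.add_apply, hfa, hfb, LinearMap.add_apply, Submodule.coe_add, map_add]
      zero_mem' := by
        refine ⟨zero_mem _, 0, isAlgebraicCorrespondence_zero hS hS (e := 2) rfl (by norm_num), fun t => ?_⟩
        rw [LinearMap.zero_apply, LinearMap.zero_apply, Submodule.coe_zero, map_zero]
      smul_mem' := by
        rintro c a ⟨haE, f, hf, hfa⟩
        refine ⟨Subalgebra.smul_mem _ haE c, (c : ℂ) • f, IsAlgebraicCorrespondence.smul hS hS hf _, fun t => ?_⟩
        rw [LinearMap.smul_apply, hfa, LinearMap.smul_apply, Submodule.coe_smul, Motives.ofRatClass_smul] }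
  have hRsE : ∀ a ∈ Rs, a ∈ T.toHodgeStructure.endAlg := fun a ha => ha.1
  have hRsmul : ∀ a ∈ Rs, ∀ a' ∈ Rs, a * a' ∈ Rs := by
    rintro a ⟨haE, f, hf, hfa⟩ a' ⟨hbE, f', hf', hfb⟩
    refine ⟨mul_mem haE hbE, f ∘ₗ f', IsAlgebraicCorrespondence.comp hS hS hS hf' hf (by norm_num), fun t => ?_⟩
    rw [LinearMap.comp_apply, hfb, hfa, Module.End.mul_apply]
  -- the `ℚ`-linear maps `T' → T` induced by algebraic correspondences `X → S`
  let Hs : Submodule ℚ (T'.toSubmodule →ₗ[ℚ] T.toSubmodule) :=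
    { carrier := {a | ∃ f : complexBetti X 2 →ₗ[ℂ] complexBetti S (2 * 1), IsAlgebraicCorrespondence 2 4 S X f ∧
          ∀ t : T'.toSubmodule, f (ι[X] (t : bettiCohomology X (2 * 1))) =
            ι[S] ((a t : T.toSubmodule) : bettiCohomology S (2 * 1))}
      add_mem' := by
        rintro a a' ⟨f, hf, hfa⟩ ⟨f', hf', hfb⟩
        refine ⟨f + f', IsAlgebraicCorrespondence.add hS hX4 hf hf', fun t => ?_⟩
        rw [LinearMap.add_apply, hfa, hfb, LinearMap.add_apply, Submodule.coe_add, map_add]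
      zero_mem' := by
        refine ⟨0, isAlgebraicCorrespondence_zero hS hX4 (e := 4) rfl (by norm_num), fun t => ?_⟩
        rw [LinearMap.zero_apply, LinearMap.zero_apply, Submodule.coe_zero, map_zero]
      smul_mem' := by
        rintro c a ⟨f, hf, hfa⟩
        refine ⟨(c : ℂ) • f, IsAlgebraicCorrespondence.smul hS hX4 hf _, fun t => ?_⟩
        rw [LinearMap.smul_apply, hfa, LinearMap.smul_apply, Submodule.coe_smul, Motives.ofRatClass_smul] }
  have hHsmul : ∀ a ∈ Hs, ∀ a' ∈ Rs, a' ∘ₗ a ∈ Hs := by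
    rintro a ⟨f, hf, hfa⟩ a' ⟨-, f', hf', hfb⟩
    refine ⟨f' ∘ₗ f, IsAlgebraicCorrespondence.comp hS hS hX4 hf hf' (by norm_num), fun t => ?_⟩
    rw [LinearMap.comp_apply, hfa, hfb, LinearMap.comp_apply]
  -- `Θ_S` as an equivalence, and the retractions `(r ⊗ 1) ∘ Θ_S⁻¹`
  let Θe : (ℂ ⊗[ℚ] bettiCohomology S (2 * 1)) ≃ₗ[ℂ] complexBetti S (2 * 1) :=
    LinearEquiv.ofBijective (Θ[S]) ⟨ofRatClassBaseChange_injective _ _, ofRatClassBaseChange_surjective hS (2 * 1)⟩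
  have hΘe : ∀ x, Θe x = Θ[S] x := fun _ => rfl
  have hΘe_symm : ∀ (c : ℂ) (w : bettiCohomology S (2 * 1)), Θe.symm (c • ι[S] w) = c ⊗ₜ[ℚ] w := by
    intro c w
    apply Θe.injective
    rw [LinearEquiv.apply_symm_apply, hΘe, ofRatClassBaseChange_tmul]
  -- DESCENT (self, on `S`): `(r ⊗ 1) Θ⁻¹ f ι` is a cycle-induced Hodge endomorphism of `T`
  have hdesc : ∀ (r : ℂ →ₗ[ℚ] ℚ) {f : complexBetti S (2 * 1) →ₗ[ℂ] complexBetti S (2 * 1)},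
      IsAlgebraicCorrespondence 2 2 S S f → ∃ a ∈ Rs, ∀ t : T.toSubmodule,
        TensorProduct.lid ℚ _ (r.rTensor _ (Θe.symm (f (ι[S] (t : bettiCohomology S (2 * 1)))))) =
          ((a t : T.toSubmodule) : bettiCohomology S (2 * 1)) := by
    intro r f hf
    obtain ⟨e, hab, γ, hγ, rfl⟩ := IsAlgebraicCorrespondence.exists_eq_corrAction hS hS hf
    suffices hc : ∀ c : ℂ, ∃ a ∈ Rs, ∀ t : T.toSubmodule,
        TensorProduct.lid ℚ _ (r.rTensor _ (Θe.symm
          (c • corrAction complexOrientationFamily hS hS hab γ (ι[S] (t : bettiCohomology S (2 * 1)))))) =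
          ((a t : T.toSubmodule) : bettiCohomology S (2 * 1)) by
      obtain ⟨a, ha, hc1⟩ := hc 1
      exact ⟨a, ha, fun t => by rw [← hc1 t, one_smul]⟩
    have hγ' := (le_of_eq (supportedClasses_eq_span_isRationalClass (hS.tensor_holds hS) (2 * e) e)) hγ
    clear hf hγ
    induction hγ' using Submodule.span_induction with
    | mem γ hγQ =>
      intro c
      obtain ⟨a, haE, ha⟩ := exists_endAlg_of_isRationalClass hS T hT hab hγQ.2 hγQ.1
      have haR : a ∈ Rs :=
        ⟨haE, _, isAlgebraicCorrespondence_corrAction_complex hS hS hab (by norm_num) hγQ.2, ha⟩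
      refine ⟨r c • a, Rs.smul_mem _ haR, fun t => ?_⟩
      rw [ha t, hΘe_symm, lid_rTensor_tmul, LinearMap.smul_apply, Submodule.coe_smul]
    | zero =>
      intro c
      refine ⟨0, Rs.zero_mem, fun t => ?_⟩
      rw [map_zero, LinearMap.zero_apply, smul_zero, map_zero, map_zero, map_zero, LinearMap.zero_apply,
        Submodule.coe_zero]
    | add γ γ' _ _ h₁ h₂ =>
      intro c
      obtain ⟨a, ha, hat⟩ := h₁ c
      obtain ⟨a', ha', hat'⟩ := h₂ c
      refine ⟨a + a', Rs.add_mem ha ha', fun t => ?_⟩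
      rw [map_add, LinearMap.add_apply, smul_add, map_add, map_add, map_add, hat, hat', LinearMap.add_apply,
        Submodule.coe_add]
    | smul c' γ _ h₁ =>
      intro c
      obtain ⟨a, ha, hat⟩ := h₁ (c * c')
      refine ⟨a, ha, fun t => ?_⟩
      rw [(corrAction complexOrientationFamily hS hS hab).map_smul, LinearMap.smul_apply, smul_smul]
      exact hat t
  -- DESCENT (cross): `(r ⊗ 1) Θ_S⁻¹ f ι_X` is induced by algebraic correspondences `X → S`
  have hdescX : ∀ (r : ℂ →ₗ[ℚ] ℚ) {f : complexBetti X 2 →ₗ[ℂ] complexBetti S (2 * 1)},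
      IsAlgebraicCorrespondence 2 4 S X f → ∃ a ∈ Hs, ∀ t : T'.toSubmodule,
        TensorProduct.lid ℚ _ (r.rTensor _ (Θe.symm (f (ι[X] (t : bettiCohomology X (2 * 1)))))) =
          ((a t : T.toSubmodule) : bettiCohomology S (2 * 1)) := by
    intro r f hf
    obtain ⟨e, hab, γ, hγ, rfl⟩ := IsAlgebraicCorrespondence.exists_eq_corrAction hS hX4 hf
    suffices hc : ∀ c : ℂ, ∃ a ∈ Hs, ∀ t : T'.toSubmodule,
        TensorProduct.lid ℚ _ (r.rTensor _ (Θe.symm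
          (c • corrAction complexOrientationFamily hS hX4 hab γ (ι[X] (t : bettiCohomology X (2 * 1)))))) =
          ((a t : T.toSubmodule) : bettiCohomology S (2 * 1)) by
      obtain ⟨a, ha, hc1⟩ := hc 1
      exact ⟨a, ha, fun t => by rw [← hc1 t, one_smul]⟩
    have hγ' := (le_of_eq (supportedClasses_eq_span_isRationalClass (hS.tensor_holds hX4) (2 * e) e)) hγ
    clear hf hγ
    induction hγ' using Submodule.span_induction with
    | mem γ hγQ =>
      intro c
      obtain ⟨a, ha⟩ := exists_homAlg_of_isRationalClass_XS hS hX T' hirr' hK3T' T htrS hab hγQ.2 hγQ.1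
      have haR : a.toLinearMap ∈ Hs :=
        ⟨_, isAlgebraicCorrespondence_corrAction_complex hS hX4 hab (by norm_num) hγQ.2, ha⟩
      refine ⟨r c • a.toLinearMap, Hs.smul_mem _ haR, fun t => ?_⟩
      rw [ha t, hΘe_symm, lid_rTensor_tmul, LinearMap.smul_apply, Submodule.coe_smul]
    | zero =>
      intro c
      refine ⟨0, Hs.zero_mem, fun t => ?_⟩
      rw [map_zero, LinearMap.zero_apply, smul_zero, map_zero, map_zero, map_zero, LinearMap.zero_apply,
        Submodule.coe_zero]
    | add γ γ' _ _ h₁ h₂ =>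
      intro c
      obtain ⟨a, ha, hat⟩ := h₁ c
      obtain ⟨a', ha', hat'⟩ := h₂ c
      refine ⟨a + a', Hs.add_mem ha ha', fun t => ?_⟩
      rw [map_add, LinearMap.add_apply, smul_add, map_add, map_add, map_add, hat, hat', LinearMap.add_apply,
        Submodule.coe_add]
    | smul c' γ _ h₁ =>
      intro c
      obtain ⟨a, ha, hat⟩ := h₁ (c * c')
      refine ⟨a, ha, fun t => ?_⟩
      rw [(corrAction complexOrientationFamily hS hX4 hab).map_smul, LinearMap.smul_apply, smul_smul]
      exact hat t
  -- a rational vector of `T'` where `f₁` does not vanish, and a retraction detecting it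
  have hzero_or : ∃ t₀ : T'.toSubmodule, (R ∘ₗ O₁) (ι[X] (t₀ : bettiCohomology X (2 * 1))) ≠ 0 := by
    by_contra hall
    push Not at hall
    have hzero : ∀ x : ℂ ⊗[ℚ] T'.toSubmodule, (R ∘ₗ O₁) (Θ[X] (T'.toSubmodule.subtype.baseChange ℂ x)) = 0 := by
      intro x
      induction x using TensorProduct.induction_on with
      | zero => rw [map_zero, map_zero, map_zero]
      | tmul c t =>
        rw [LinearMap.baseChange_tmul, Submodule.subtype_apply, ofRatClassBaseChange_tmul, map_smul, hall t,
          smul_zero]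
      | add x y hx hy => rw [map_add, map_add, map_add, hx, hy, add_zero]
    exact hΦ₁σ (by rw [← hx₀]; exact hzero x₀)
  obtain ⟨t₀, ht₀⟩ := hzero_or
  have hξ : Θe.symm ((R ∘ₗ O₁) (ι[X] (t₀ : bettiCohomology X (2 * 1)))) ≠ 0 := fun h0 =>
    ht₀ (by simpa only [LinearEquiv.apply_symm_apply, map_zero] using congrArg Θe h0)
  obtain ⟨r, hr⟩ := exists_rat_retraction_ne_zero hξ
  -- the descended maps `a₁ ∈ Hs`, `a₂ ∈ Rs` with `a₂ ∘ h_T = a₁ ≠ 0`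
  obtain ⟨a₁, ha₁R, ha₁⟩ := hdescX r hΦ₁
  obtain ⟨a₂, ha₂R, ha₂⟩ := hdesc r hΦ₂
  have ha₁0 : a₁ ≠ 0 := fun h0 => hr (by rw [ha₁ t₀, h0, LinearMap.zero_apply, Submodule.coe_zero])
  have hmulrel : a₂ ∘ₗ hTT.toLinearMap = a₁ := by
    refine LinearMap.ext fun t => Subtype.ext ?_
    rw [LinearMap.comp_apply, ← ha₂, ← ha₁, hhT, hrel t]
  have ha₂0 : a₂ ≠ 0 := by rintro rfl; exact ha₁0 (by rw [← hmulrel, LinearMap.zero_comp])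
  -- Zarhin: `End_Hdg(T(S)_ℚ)` is a field; the inverse of `a₂` lies in `Rs` by the subfield trick
  obtain ⟨hField, -⟩ := Zarhin1983_endAlg_isField_holds T.toHodgeStructure hirr hK3
  have ha₂E : a₂ ∈ T.toHodgeStructure.endAlg := hRsE _ ha₂R
  obtain ⟨ai, hai⟩ := hField.mul_inv_cancel (show (⟨a₂, ha₂E⟩ : T.toHodgeStructure.endAlg) ≠ 0 from
    fun h0 => ha₂0 (congrArg Subtype.val h0))
  have hab : a₂ * (ai : Module.End ℚ T.toSubmodule) = 1 := by
    have hh := congrArg Subtype.val hai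
    simpa only [Subalgebra.coe_mul, Subalgebra.coe_one] using hh
  have hba : (ai : Module.End ℚ T.toSubmodule) * a₂ = 1 := by
    rw [hField.mul_comm ⟨a₂, ha₂E⟩ ai] at hai
    have hh := congrArg Subtype.val hai
    simpa only [Subalgebra.coe_mul, Subalgebra.coe_one] using hh
  have haiR : (ai : Module.End ℚ T.toSubmodule) ∈ Rs :=
    mem_of_mul_eq_of_isField hField Rs hRsE hRsmul ha₂R (hRsmul _ ha₂R _ ha₂R) ai.2 ha₂0
      (by rw [mul_assoc, hab]; exact mul_one a₂)
  obtain ⟨-, f₃, hf₃, hf₃b⟩ := haiR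
  obtain ⟨f₁, hf₁, hf₁a⟩ := ha₁R
  -- `Φ = f₃ ∘ f₁`
  refine ⟨f₃ ∘ₗ f₁, IsAlgebraicCorrespondence.comp hS hS hX4 hf₁ hf₃ (by norm_num), fun y hy => ?_⟩
  have hpt : ∀ t : T'.toSubmodule, (f₃ ∘ₗ f₁) (ι[X] (t : bettiCohomology X (2 * 1))) =
      h (ι[X] (t : bettiCohomology X (2 * 1))) := by
    intro t
    rw [LinearMap.comp_apply, hf₁a, hf₃b, ← hhT]
    congr 2
    have hh := congrArg (fun G : Module.End ℚ T.toSubmodule => G (hTT.toLinearMap t)) hba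
    simp only [Module.End.mul_apply, Module.End.one_apply] at hh
    rw [← hh]
    congr 1
    have h' := congrArg (fun G : T'.toSubmodule →ₗ[ℚ] T.toSubmodule => G t) hmulrel
    simp only [LinearMap.comp_apply] at h'
    exact h'.symm
  obtain ⟨x, rfl⟩ := exists_baseChange_eq_of_bbfTransc hX hM T' hT' hy
  clear hy
  induction x using TensorProduct.induction_on with
  | zero => rw [map_zero, map_zero, map_zero, map_zero]
  | tmul c t =>
    rw [LinearMap.baseChange_tmul, Submodule.subtype_apply, ofRatClassBaseChange_tmul, map_smul, map_smul, hpt t]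
  | add x y hx hy => rw [map_add, map_add, map_add, map_add, hx, hy]

end Summit.HodgeConjecture.HodgeConjecture.Theorems.MarkmanPartnerTransport.KugaSatakeMixed

end
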